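import Mathlib
import Summits.AtomisticToContinuum.FouriersLaw.Theorems.EmbeddedDrudeMourreKineticConductivityFiniteAlgebra
import Summits.AtomisticToContinuum.FouriersLaw.Theorems.EmbeddedDrudeMourreKineticConductivityFiniteFormDomain
import HarnessLib

/-!
# Effective Jacobian floor on the resonant set — `stub_jacobianFloor` (stub GL) of line `swap-odd-threshold-rigidity`
(crux `EmbeddedDrudeMourre.MourreDissolution`, item stmt-AtomisticToContinuum-12594; helper file, `--supports`)

Registered stub GL of the checked skeleton of line `swap-odd-threshold-rigidity` (lead c8), in the
skeleton's stub namespace `Summit.AtomisticToContinuum.FouriersLaw.Theorems.MourreDissolution`,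
registered in the shape `I1 → GL` (the global factorisation I1 of the resonance function is taken as a
HYPOTHESIS; it is not restated or reproved here).

For the pinned band `ω(k) = √(ω₂ + 2(1 − cos k))` (`PhononBoltzmann.dispersion`, `ω₂ > 0`), the
resonance function `Ω(k₁,k₂,k₃) = ω₁ + ω₂ − ω₃ − ω₄` (`resonanceFn`; `ωⱼ = ω(kⱼ)`, `k₄ = k₁ + k₂ − k₃`)
and the resolved-delta Jacobian `J = |ω′(k₂) − ω′(k₄)|` (`resonanceJacobian`, `ω′ = sin/ω`):
there is `c = c(ω₂) > 0` with `c·|sin((k₃−k₁)/2) sin((k₂−k₃)/2)| ≤ J` at every real zero of `Ω`.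

Proof. Write `p = (k₃−k₁)/2`, `q = (k₂−k₃)/2`, `r = (k₁+k₂)/2`, `σ = sin p sin q`. If `σ = 0` there is
nothing to show. Otherwise:
* by I1 at a zero of `Ω`, `8σ·H = 0`, so `H = (ω₁ω₂+ω₃ω₄+2(ω₂+2)) cos r − 4 cos p cos q = 0`; since
  `ω₁ω₂ + ω₃ω₄ ≥ 2ω₂` (`√ω₂ ≤ ω`), `|cos r| ≤ 4/(4+4ω₂)`, i.e. `sin² r ≥ 1 − (1+ω₂)⁻²`, and
  `|sin r| ≥ sin² r`;
* `σ ≠ 0` gives the non-triviality hypothesis `cos((k₁−k₂)/2) ≠ cos(k₃ − (k₁+k₂)/2)` of the tree's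
  `KineticConductivityFinite.sin_bracket_identity` (`Real.cos_eq_cos_iff`), whence on shell
  `(ω₂+ω₄)(sin k₁+sin k₂−sin k₃−sin k₄) = 4(ω₄ sin k₂ − ω₂ sin k₄)`;
* `sin k₁ + sin k₂ − sin k₃ − sin k₄ = −4 σ sin r` (sum-to-product twice);
* so `J = |sin k₂/ω₂ − sin k₄/ω₄| = (1/ω₂ + 1/ω₄)|σ||sin r| ≥ (2/(ω₂+4))·(1 − (1+ω₂)⁻²)·|σ|`
  (`ω ≤ ω₂ + 4` from `ω² ≤ ω₂ + 4`).
The constant used is `c = (2/(ω₂+4))·(1 − (1/(1+ω₂))²)`. Pure algebra/trigonometry; no cited facts.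
-/

noncomputable section

namespace Summit.AtomisticToContinuum.FouriersLaw.Theorems.MourreDissolution

open Literature.MathematicalPhysics.KineticTheory
open Literature.MathematicalPhysics.KineticTheory.PhononBoltzmann
open Summit.AtomisticToContinuum.FouriersLaw.Theorems.KineticConductivityFinite

/-! ### Trigonometric inputs -/

/-- `sin(r−p−q) + sin(r+p+q) − sin(r+p−q) − sin(r−p+q) = −4 sin p sin q sin r`
(sum-to-product twice). [folklore] -/
theorem jacobianFloor_sin_four (p q r : ℝ) :
    Real.sin (r - p - q) + Real.sin (r + p + q) - Real.sin (r + p - q) - Real.sin (r - p + q) =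
      -4 * Real.sin p * Real.sin q * Real.sin r := by
  simp only [Real.sin_add, Real.sin_sub, Real.cos_add, Real.cos_sub]
  ring

/-- The `sin` bracket in half-angle variables:
`sin k₁ + sin k₂ − sin k₃ − sin(k₁+k₂−k₃) = −4 sin((k₃−k₁)/2) sin((k₂−k₃)/2) sin((k₁+k₂)/2)`.
[folklore] -/
theorem jacobianFloor_sin_bracket (k₁ k₂ k₃ : ℝ) :
    Real.sin k₁ + Real.sin k₂ - Real.sin k₃ - Real.sin (k₁ + k₂ - k₃) =
      -4 * Real.sin ((k₃ - k₁) / 2) * Real.sin ((k₂ - k₃) / 2) * Real.sin ((k₁ + k₂) / 2) := by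
  have h := jacobianFloor_sin_four ((k₃ - k₁) / 2) ((k₂ - k₃) / 2) ((k₁ + k₂) / 2)
  have e₁ : (k₁ + k₂) / 2 - (k₃ - k₁) / 2 - (k₂ - k₃) / 2 = k₁ := by ring
  have e₂ : (k₁ + k₂) / 2 + (k₃ - k₁) / 2 + (k₂ - k₃) / 2 = k₂ := by ring
  have e₃ : (k₁ + k₂) / 2 + (k₃ - k₁) / 2 - (k₂ - k₃) / 2 = k₃ := by ring
  have e₄ : (k₁ + k₂) / 2 - (k₃ - k₁) / 2 + (k₂ - k₃) / 2 = k₁ + k₂ - k₃ := by ring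
  rw [e₁, e₂, e₃, e₄] at h
  exact h

/-- Off the two exchange planes the half-angle cosines of `sin_bracket_identity` differ: if
`sin((k₃−k₁)/2) sin((k₂−k₃)/2) ≠ 0` then `cos((k₁−k₂)/2) ≠ cos(k₃ − (k₁+k₂)/2)`
(`Real.cos_eq_cos_iff`: equality forces `k₃ − k₁ ∈ 2πℤ` or `k₃ − k₂ ∈ 2πℤ`). [folklore] -/
theorem jacobianFloor_cos_half_ne {k₁ k₂ k₃ : ℝ}
    (hσ : Real.sin ((k₃ - k₁) / 2) * Real.sin ((k₂ - k₃) / 2) ≠ 0) :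
    Real.cos ((k₁ - k₂) / 2) ≠ Real.cos (k₃ - (k₁ + k₂) / 2) := by
  intro h
  obtain ⟨m, hm | hm⟩ := Real.cos_eq_cos_iff.1 h
  · -- `k₃ = 2mπ + k₁`
    have e : (k₃ - k₁) / 2 = (m : ℝ) * Real.pi := by linarith
    apply hσ
    rw [e, Real.sin_int_mul_pi, zero_mul]
  · -- `k₃ = 2mπ + k₂`
    have e : (k₂ - k₃) / 2 = -((m : ℝ) * Real.pi) := by linarith
    apply hσ
    rw [e, Real.sin_neg, Real.sin_int_mul_pi, neg_zero, mul_zero]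

/-! ### The two elementary estimates -/

/-- From the collision sheet `H = 0`: if `(P + 2(ω₂+2))·cr = 4·cp·cq` with `P ≥ 2ω₂ > 0`,
`cp² ≤ 1`, `cq² ≤ 1` and `sr² + cr² = 1`, then `sr² ≥ 1 − (1+ω₂)⁻²`. [folklore] -/
theorem jacobianFloor_sin_sq_ge {ω₂ P cr cp cq sr : ℝ} (hω : 0 < ω₂) (hP : 2 * ω₂ ≤ P)
    (hH : (P + 2 * (ω₂ + 2)) * cr - 4 * cp * cq = 0) (hcp : cp ^ 2 ≤ 1) (hcq : cq ^ 2 ≤ 1)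
    (hsc : sr ^ 2 + cr ^ 2 = 1) :
    1 - (1 / (1 + ω₂)) ^ 2 ≤ sr ^ 2 := by
  have hD : 4 * (1 + ω₂) ≤ P + 2 * (ω₂ + 2) := by linarith
  have hD0 : (0 : ℝ) ≤ 4 * (1 + ω₂) := by positivity
  have h1 : (P + 2 * (ω₂ + 2)) ^ 2 * cr ^ 2 ≤ 16 := by
    have e : (P + 2 * (ω₂ + 2)) * cr = 4 * cp * cq := by linarith
    have hpq : cp ^ 2 * cq ^ 2 ≤ 1 := by
      calc cp ^ 2 * cq ^ 2 ≤ 1 * 1 := mul_le_mul hcp hcq (sq_nonneg _) zero_le_one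
        _ = 1 := by ring
    calc (P + 2 * (ω₂ + 2)) ^ 2 * cr ^ 2 = ((P + 2 * (ω₂ + 2)) * cr) ^ 2 := by ring
      _ = 16 * (cp ^ 2 * cq ^ 2) := by rw [e]; ring
      _ ≤ 16 := by linarith
  have h2 : (4 * (1 + ω₂)) ^ 2 * cr ^ 2 ≤ (P + 2 * (ω₂ + 2)) ^ 2 * cr ^ 2 :=
    mul_le_mul_of_nonneg_right (pow_le_pow_left₀ hD0 hD 2) (sq_nonneg _)
  have h3 : cr ^ 2 * (1 + ω₂) ^ 2 ≤ 1 := by nlinarith [h1, h2]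
  have h4 : cr ^ 2 ≤ (1 / (1 + ω₂)) ^ 2 := by
    rw [div_pow, one_pow, le_div_iff₀ (by positivity)]
    exact h3
  linarith

/-- The order-theoretic core: with `J = |s₂/w₂ − s₄/w₄|`, `w₄ s₂ − w₂ s₄ = −(w₂+w₄)·σ·sr`,
`0 < w₂, w₄ ≤ ω₂ + 4` and `0 ≤ c₂ ≤ |sr|`: `(2/(ω₂+4))·c₂·|σ| ≤ J`. [folklore] -/
theorem jacobianFloor_alg {ω₂ w₂ w₄ s₂ s₄ σ sr c₂ : ℝ} (hω : 0 < ω₂)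
    (hw₂ : 0 < w₂) (hw₄ : 0 < w₄) (hw₂' : w₂ ≤ ω₂ + 4) (hw₄' : w₄ ≤ ω₂ + 4)
    (hkey : w₄ * s₂ - w₂ * s₄ = -((w₂ + w₄) * σ * sr))
    (hc₂ : 0 ≤ c₂) (hsr : c₂ ≤ |sr|) :
    2 / (ω₂ + 4) * c₂ * |σ| ≤ |s₂ / w₂ - s₄ / w₄| := by
  have hw₂0 : w₂ ≠ 0 := hw₂.ne'
  have hw₄0 : w₄ ≠ 0 := hw₄.ne'
  have hx : (s₂ / w₂ - s₄ / w₄) * (w₂ * w₄) = -((w₂ + w₄) * σ * sr) := by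
    rw [← hkey]
    field_simp
  have habs : |s₂ / w₂ - s₄ / w₄| * (w₂ * w₄) = (w₂ + w₄) * |σ| * |sr| := by
    rw [← abs_of_pos (mul_pos hw₂ hw₄), ← abs_mul, hx, abs_neg, abs_mul, abs_mul,
      abs_of_pos (add_pos hw₂ hw₄)]
  have hc₁ : 2 / (ω₂ + 4) * (w₂ * w₄) ≤ w₂ + w₄ := by
    rw [div_mul_eq_mul_div, div_le_iff₀ (by positivity : (0 : ℝ) < ω₂ + 4)]
    nlinarith [mul_le_mul_of_nonneg_right hw₂' hw₄.le, mul_le_mul_of_nonneg_right hw₄' hw₂.le]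
  refine le_of_mul_le_mul_right ?_ (mul_pos hw₂ hw₄)
  rw [habs]
  calc 2 / (ω₂ + 4) * c₂ * |σ| * (w₂ * w₄)
      = (2 / (ω₂ + 4) * (w₂ * w₄)) * (c₂ * |σ|) := by ring
    _ ≤ (w₂ + w₄) * (|sr| * |σ|) :=
        mul_le_mul hc₁ (mul_le_mul_of_nonneg_right hsr (abs_nonneg _)) (by positivity)
          (by positivity)
    _ = (w₂ + w₄) * |σ| * |sr| := by ring

/-! ### The Jacobian floor -/

/-- **Effective Jacobian floor on the resonant set** (stub GL of line `swap-odd-threshold-rigidity`,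
registered as `I1 → GL`). Assuming the global factorisation
`Ω·(ω₁+ω₂+ω₃+ω₄)·(ω₁ω₂+ω₃ω₄) = 8 sin((k₃−k₁)/2) sin((k₂−k₃)/2)·H` of the resonance function (I1):
for every `ω₂ > 0` there is `c > 0` with
`c·|sin((k₃−k₁)/2) sin((k₂−k₃)/2)| ≤ |ω′(k₂) − ω′(k₁+k₂−k₃)| = resonanceJacobian ω₂ k₁ k₂ k₃`
at every real zero of `Ω` (the constant used is `(2/(ω₂+4))·(1 − (1/(1+ω₂))²)`). [folklore] -/
theorem stub_jacobianFloor :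
    (∀ ω₂ : ℝ, 0 ≤ ω₂ → ∀ k₁ k₂ k₃ : ℝ,
      resonanceFn ω₂ k₁ k₂ k₃ *
          ((dispersion ω₂ k₁ + dispersion ω₂ k₂ + dispersion ω₂ k₃ + dispersion ω₂ (k₁ + k₂ - k₃)) *
            (dispersion ω₂ k₁ * dispersion ω₂ k₂ + dispersion ω₂ k₃ * dispersion ω₂ (k₁ + k₂ - k₃))) =
        8 * Real.sin ((k₃ - k₁) / 2) * Real.sin ((k₂ - k₃) / 2) *
          ((dispersion ω₂ k₁ * dispersion ω₂ k₂ + dispersion ω₂ k₃ * dispersion ω₂ (k₁ + k₂ - k₃) +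
                2 * (ω₂ + 2)) * Real.cos ((k₁ + k₂) / 2) -
            4 * Real.cos ((k₃ - k₁) / 2) * Real.cos ((k₂ - k₃) / 2))) →
    ∀ ω₂ : ℝ, 0 < ω₂ → ∃ c : ℝ, 0 < c ∧ ∀ k₁ k₂ k₃ : ℝ, resonanceFn ω₂ k₁ k₂ k₃ = 0 →
      c * |Real.sin ((k₃ - k₁) / 2) * Real.sin ((k₂ - k₃) / 2)| ≤ resonanceJacobian ω₂ k₁ k₂ k₃ := by
  intro hI1 ω₂ hω
  have hc₂ : 0 < 1 - (1 / (1 + ω₂)) ^ 2 := by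
    have h : (1 / (1 + ω₂)) ^ 2 < 1 := by
      rw [div_pow, one_pow, div_lt_one (by positivity)]
      nlinarith
    linarith
  refine ⟨2 / (ω₂ + 4) * (1 - (1 / (1 + ω₂)) ^ 2), mul_pos (by positivity) hc₂, ?_⟩
  intro k₁ k₂ k₃ hres
  by_cases hσ : Real.sin ((k₃ - k₁) / 2) * Real.sin ((k₂ - k₃) / 2) = 0
  · rw [hσ, abs_zero, mul_zero]
    exact abs_nonneg _
  -- (i) on the resonant set, off the exchange planes, the collision-sheet equation `H = 0` holds
  have hH : (dispersion ω₂ k₁ * dispersion ω₂ k₂ + dispersion ω₂ k₃ * dispersion ω₂ (k₁ + k₂ - k₃) +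
        2 * (ω₂ + 2)) * Real.cos ((k₁ + k₂) / 2) -
      4 * Real.cos ((k₃ - k₁) / 2) * Real.cos ((k₂ - k₃) / 2) = 0 := by
    have h := hI1 ω₂ hω.le k₁ k₂ k₃
    rw [hres, zero_mul] at h
    have h8 : 8 * Real.sin ((k₃ - k₁) / 2) * Real.sin ((k₂ - k₃) / 2) ≠ 0 := by
      rw [mul_assoc]
      exact mul_ne_zero (by norm_num) hσ
    exact (mul_eq_zero.1 h.symm).resolve_left h8
  -- `ω₁ω₂ + ω₃ω₄ ≥ 2ω₂`
  have hP : 2 * ω₂ ≤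
      dispersion ω₂ k₁ * dispersion ω₂ k₂ + dispersion ω₂ k₃ * dispersion ω₂ (k₁ + k₂ - k₃) := by
    have hs : Real.sqrt ω₂ * Real.sqrt ω₂ = ω₂ := Real.mul_self_sqrt hω.le
    have h12 : Real.sqrt ω₂ * Real.sqrt ω₂ ≤ dispersion ω₂ k₁ * dispersion ω₂ k₂ :=
      mul_le_mul (sqrt_le_dispersion k₁) (sqrt_le_dispersion k₂) (Real.sqrt_nonneg _)
        (dispersion_pos hω _).le
    have h34 : Real.sqrt ω₂ * Real.sqrt ω₂ ≤ dispersion ω₂ k₃ * dispersion ω₂ (k₁ + k₂ - k₃) :=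
      mul_le_mul (sqrt_le_dispersion k₃) (sqrt_le_dispersion _) (Real.sqrt_nonneg _)
        (dispersion_pos hω _).le
    linarith
  -- hence `|sin((k₁+k₂)/2)| ≥ 1 − (1+ω₂)⁻²`
  have hsr2 : 1 - (1 / (1 + ω₂)) ^ 2 ≤ Real.sin ((k₁ + k₂) / 2) ^ 2 :=
    jacobianFloor_sin_sq_ge hω hP hH (Real.cos_sq_le_one _) (Real.cos_sq_le_one _)
      (Real.sin_sq_add_cos_sq _)
  have hsr1 : 1 - (1 / (1 + ω₂)) ^ 2 ≤ |Real.sin ((k₁ + k₂) / 2)| := by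
    have h1 : |Real.sin ((k₁ + k₂) / 2)| ≤ 1 := Real.abs_sin_le_one _
    have h0 : 0 ≤ |Real.sin ((k₁ + k₂) / 2)| := abs_nonneg _
    have h2 : Real.sin ((k₁ + k₂) / 2) ^ 2 ≤ |Real.sin ((k₁ + k₂) / 2)| := by
      calc Real.sin ((k₁ + k₂) / 2) ^ 2
          = |Real.sin ((k₁ + k₂) / 2)| * |Real.sin ((k₁ + k₂) / 2)| := by rw [← sq_abs]; ring
        _ ≤ |Real.sin ((k₁ + k₂) / 2)| * 1 := mul_le_mul_of_nonneg_left h1 h0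
        _ = |Real.sin ((k₁ + k₂) / 2)| := mul_one _
    linarith
  -- (ii)+(iii) the `sin` bracket identity on the non-trivial branch, in half-angle form
  have hB := sin_bracket_identity hω hres (jacobianFloor_cos_half_ne hσ)
  rw [jacobianFloor_sin_bracket] at hB
  have hkey : dispersion ω₂ (k₁ + k₂ - k₃) * Real.sin k₂ - dispersion ω₂ k₂ * Real.sin (k₁ + k₂ - k₃) =
      -((dispersion ω₂ k₂ + dispersion ω₂ (k₁ + k₂ - k₃)) *
          (Real.sin ((k₃ - k₁) / 2) * Real.sin ((k₂ - k₃) / 2)) * Real.sin ((k₁ + k₂) / 2)) := by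
    linear_combination (-1 / 4 : ℝ) * hB
  -- (iv) `ω ≤ ω₂ + 4`
  have hwle : ∀ k : ℝ, dispersion ω₂ k ≤ ω₂ + 4 := fun k => by
    have h1 := dispersion_sq_le hω.le k
    have h2 := dispersion_pos hω k
    nlinarith
  -- assemble
  show _ ≤ |Real.sin k₂ / dispersion ω₂ k₂ -
      Real.sin (k₁ + k₂ - k₃) / dispersion ω₂ (k₁ + k₂ - k₃)|
  exact jacobianFloor_alg hω (dispersion_pos hω _) (dispersion_pos hω _) (hwle _) (hwle _) hkey
    hc₂.le hsr1

end Summit.AtomisticToContinuum.FouriersLaw.Theorems.MourreDissolution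

end
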